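import Summits.MatrixMultiplication.OmegaCensus.DicyclicLawQuotientCyclicTwoTwo
import Summits.MatrixMultiplication.OmegaCensus.DicyclicLawQuotientCyclicShapeBTPP
import Summits.MatrixMultiplication.OmegaCensus.DicyclicNoCubeLaw
import Summits.MatrixMultiplication.OmegaCensus.C2DihedralLawGap
import HarnessLib

/-!
# The dicyclic-type law classification: `c₀ ≠ 0` and the mod-one law force `A/⟨c₀⟩` cyclic

ω-census, family (b3).  Framing: lottery ticket; floor = certified bounds/negative ranges.

Dihedral-like presentation `ρ, τ : A → G` over a finite abelian group `A` with `τa τb = ρ(c₀ + b − a)` and **`c₀ ≠ 0`**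
(generalized dicyclic groups: `Q_{4n}`, `C₂ × Q_{4n}`, `ℤ_n ⋊ ℤ₄`, …), `|A| ≡ 1 (mod 3)`, `|A| ≥ 14`.

**Theorem (`quot_cyclic_of_mod_one_law_of_c0_ne_zero`).** If a TPP triple attains the law `3|S||T||U| + 8 = 8|A|`, then
`A = ⟨g⟩ ∪ (c₀ + ⟨g⟩)` for some `g ∈ A` — i.e. **`A/⟨c₀⟩` is cyclic**.  (Previously known: `A` is two cosets of SOME cyclic
subgroup, `DicyclicLawModOneClassification.lean`; the new information is which cosets.)
Proof: by `no_cube_law_of_c0_ne_zero` the triple is not a cube, so by `mod_one_law_shape` it has the two-two shape or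
shape B (up to roles).  Two-two: `TPPSaturation.parts_periodic_of_two_two_law` makes the big set `ρ(c₀)`-invariant, so the
near-tiling of `DihedralLawModOneTwoCosets` is `c₀`-periodic and `near_tiling_two_periodic` applies
(`DicyclicLawQuotientCyclicTwoTwo.lean`; the balanced sub-shape dies by parity).  Shape B: the periodicity hypothesis (Per)
of `DihedralLawModOneShapeBCore` makes `P = Y ⊔ (Y + t)` periodic and `three_pieces_periodic` applies
(`DicyclicLawQuotientCyclicShapeB(TPP).lean`).

**Corollaries.**
* `no_mod_one_law_of_c0_double` — if `c₀ ∈ 2A` (`c₀ = a + a`) and `A` is not cyclic, NO TPP triple attains the law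
  (from `A = ⟨g⟩ ∪ (c₀ + ⟨g⟩)` and `c₀ = 2a` one gets `c₀ ∈ ⟨g⟩`, so `A = ⟨g⟩`).
* `no_mod_one_law_Z2_Zn_half` — the census hypothesis **H′**: over `A = ℤ₂ × ℤ_n` with `4 ∣ n` and `c₀ = (0, n/2)` — the
  groups **`C₂ × Q_{2n}`, `|A| = 2n ∈ {16, 40, 64, 88, …}`** — no TPP triple attains `3|S||T||U| + 8 = 8|A|`, although `A`
  has the cyclic subgroup `ℤ_n` of index `2` (so the per-group converse of the `A`-level classification fails exactly here;
  the group g7 computation `C₂ × Q₁₆: no law triple` is the case `n = 8`).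

**The resulting classification of dicyclic-type groups at the mod-one law** (`c₀ ≠ 0`, `|A| ≡ 1 (mod 3)`, `|A| ≥ 14`):
the law is attained **iff `A/⟨c₀⟩ is cyclic**.  Necessity is this file; sufficiency: `A/⟨c₀⟩ ≅ ℤ_m` cyclic forces
`(A, c₀) ≅ (ℤ_{2m}, m)` — the group `Q_{4m}`, law attained by `quaternion_volume_ge_law` (`DicyclicLift.lean`) — or
`(A, c₀) ≅ (ℤ₂ × ℤ_m, (1, 0))` — the group `ℤ_m ⋊ ℤ₄`, law attained by `z2zn_mod_one_law_attained`
(`DihedralLikeModel.lean`).  (For `c₀ = 0`, i.e. `Dih(A)`, the classification 'iff `A` has a cyclic subgroup of index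
`≤ 2`' remains the census conjecture, proved for many orders.)
-/

namespace Summit.MatrixMultiplication.OmegaCensus

open Literature.Combinatorics.Additive Finset

section DihedralLike

variable {A : Type*} [AddCommGroup A] [DecidableEq A] [Fintype A] {G : Type} [Group G] [DecidableEq G]
  {ρ τ : A → G} {c₀ : A} {S T U : Finset G}

/-- **Non-cube law shapes at `c₀ ≠ 0` force `A = ⟨g⟩ ∪ (c₀ + ⟨g⟩)`** (the case analysis of
`two_cosets_of_mod_one_law_of_not_cube` with the periodic leaves). [folklore] -/
theorem quot_cyclic_of_mod_one_law_of_not_cube_c0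
    (hρρ : ∀ a b, ρ a * ρ b = ρ (a + b)) (hρτ : ∀ a b, ρ a * τ b = τ (b - a))
    (hτρ : ∀ a b, τ a * ρ b = τ (a + b)) (hττ : ∀ a b, τ a * τ b = ρ (c₀ + b - a))
    (hρ : Function.Injective ρ) (hτ : Function.Injective τ) (hne : ∀ a b, ρ a ≠ τ b)
    (hsurj : ∀ g, (∃ a, ρ a = g) ∨ (∃ a, τ a = g)) (hmod : Fintype.card A % 3 = 1) (hA : 14 ≤ Fintype.card A)
    (h : TripleProductProperty S T U) (hV : 3 * (S.card * T.card * U.card) + 8 = 8 * Fintype.card A)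
    (hnc : ¬ ((univ.filter fun a : A => ρ a ∈ S).card = (univ.filter fun a : A => τ a ∈ S).card ∧
      (univ.filter fun a : A => ρ a ∈ T).card = (univ.filter fun a : A => τ a ∈ T).card ∧
      (univ.filter fun a : A => ρ a ∈ U).card = (univ.filter fun a : A => τ a ∈ U).card)) (hc₀ : c₀ ≠ 0) :
    ∃ g : A, ∀ x : A, x ∈ AddSubgroup.zmultiples g ∨ x + c₀ ∈ AddSubgroup.zmultiples g := by
  have hshape := mod_one_law_shape hρρ hρτ hτρ hττ hρ hτ hne hsurj hA h hV
  have cS := card_eq_parts' hρ hτ hne hsurj S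
  have cT := card_eq_parts' hρ hτ hne hsurj T
  have cU := card_eq_parts' hρ hτ hne hsurj U
  set s₀ := (univ.filter fun a : A => ρ a ∈ S).card with hs₀
  set s₁ := (univ.filter fun a : A => τ a ∈ S).card with hs₁
  set t₀ := (univ.filter fun a : A => ρ a ∈ T).card with ht₀
  set t₁ := (univ.filter fun a : A => τ a ∈ T).card with ht₁
  set u₀ := (univ.filter fun a : A => ρ a ∈ U).card with hu₀
  set u₁ := (univ.filter fun a : A => τ a ∈ U).card with hu₁
  have hA7 : 7 ≤ Fintype.card A := by omega
  -- the law in the six role orders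
  have hV_TUS : 3 * (T.card * U.card * S.card) + 8 = 8 * Fintype.card A := by
    rw [show T.card * U.card * S.card = S.card * T.card * U.card by ring]; exact hV
  have hV_UST : 3 * (U.card * S.card * T.card) + 8 = 8 * Fintype.card A := by
    rw [show U.card * S.card * T.card = S.card * T.card * U.card by ring]; exact hV
  have hV_SUT : 3 * (S.card * U.card * T.card) + 8 = 8 * Fintype.card A := by
    rw [show S.card * U.card * T.card = S.card * T.card * U.card by ring]; exact hV
  have hV_TSU : 3 * (T.card * S.card * U.card) + 8 = 8 * Fintype.card A := by
    rw [show T.card * S.card * U.card = S.card * T.card * U.card by ring]; exact hV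
  have hV_UTS : 3 * (U.card * T.card * S.card) + 8 = 8 * Fintype.card A := by
    rw [show U.card * T.card * S.card = S.card * T.card * U.card by ring]; exact hV
  -- the rotated / reversed triples
  have hTUS : TripleProductProperty T U S := h.rotate
  have hUST : TripleProductProperty U S T := h.rotate.rotate
  have hSUT : TripleProductProperty S U T := tpp_reverse h.rotate
  have hTSU : TripleProductProperty T S U := tpp_reverse h.rotate.rotate
  have hUTS : TripleProductProperty U T S := tpp_reverse h
  rcases hshape with ⟨e1, e2, e3⟩ | ⟨et, eu, hcase⟩ | ⟨es, eu, hcase⟩ | ⟨es, et, hcase⟩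
  · exact absurd ⟨e1, e2, e3⟩ hnc
  · -- `S` unbalanced, `T`, `U` balanced
    rcases hcase with ⟨hp, hs⟩ | ⟨hp, hs⟩
    · -- `t₀ u₀ = 1`: `|T| = |U| = 2`, roles `(T, U, S)`
      have ht : t₀ = 1 := Nat.eq_one_of_mul_eq_one_right hp
      have hu : u₀ = 1 := Nat.eq_one_of_mul_eq_one_left hp
      exact quot_cyclic_of_two_two_law hρρ hρτ hτρ hττ hρ hτ hne hsurj hmod hA7 hTUS (by omega) (by omega) hV_TUS hc₀
    · -- `t₀ u₀ = 2`
      have htu : (t₀ = 2 ∧ u₀ = 1) ∨ (t₀ = 1 ∧ u₀ = 2) := by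
        have h2 : t₀ ∣ 2 := ⟨u₀, hp.symm⟩
        have ht2 : t₀ ≤ 2 := Nat.le_of_dvd (by norm_num) h2
        interval_cases t₀ <;> omega
      rcases htu with ⟨ht, hu⟩ | ⟨ht, hu⟩
      · exact quot_cyclic_of_shapeB_tpp_or hρρ hρτ hτρ hττ hρ hτ hne hsurj h (by omega) ht (by omega) hu
          (by omega) hV hc₀
      · exact quot_cyclic_of_shapeB_tpp_or hρρ hρτ hτρ hττ hρ hτ hne hsurj hSUT (by omega) hu (by omega) ht
          (by omega) hV_SUT hc₀
  · -- `T` unbalanced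
    rcases hcase with ⟨hp, hs⟩ | ⟨hp, hs⟩
    · have hs1 : s₀ = 1 := Nat.eq_one_of_mul_eq_one_right hp
      have hu : u₀ = 1 := Nat.eq_one_of_mul_eq_one_left hp
      -- `|U| = |S| = 2`: roles `(U, S, T)`
      exact quot_cyclic_of_two_two_law hρρ hρτ hτρ hττ hρ hτ hne hsurj hmod hA7 hUST (by omega) (by omega) hV_UST hc₀
    · have hsu : (s₀ = 2 ∧ u₀ = 1) ∨ (s₀ = 1 ∧ u₀ = 2) := by
        have h2 : s₀ ∣ 2 := ⟨u₀, hp.symm⟩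
        have hs2 : s₀ ≤ 2 := Nat.le_of_dvd (by norm_num) h2
        interval_cases s₀ <;> omega
      rcases hsu with ⟨hs2, hu⟩ | ⟨hs2, hu⟩
      · -- roles `(T, S, U)`
        exact quot_cyclic_of_shapeB_tpp_or hρρ hρτ hτρ hττ hρ hτ hne hsurj hTSU (by omega) hs2 (by omega) hu
          (by omega) hV_TSU hc₀
      · -- roles `(T, U, S)`
        exact quot_cyclic_of_shapeB_tpp_or hρρ hρτ hτρ hττ hρ hτ hne hsurj hTUS (by omega) hu (by omega) hs2
          (by omega) hV_TUS hc₀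
  · -- `U` unbalanced
    rcases hcase with ⟨hp, hs⟩ | ⟨hp, hs⟩
    · have hs1 : s₀ = 1 := Nat.eq_one_of_mul_eq_one_right hp
      have ht : t₀ = 1 := Nat.eq_one_of_mul_eq_one_left hp
      exact quot_cyclic_of_two_two_law hρρ hρτ hτρ hττ hρ hτ hne hsurj hmod hA7 h (by omega) (by omega) hV hc₀
    · have hst : (s₀ = 2 ∧ t₀ = 1) ∨ (s₀ = 1 ∧ t₀ = 2) := by
        have h2 : s₀ ∣ 2 := ⟨t₀, hp.symm⟩
        have hs2 : s₀ ≤ 2 := Nat.le_of_dvd (by norm_num) h2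
        interval_cases s₀ <;> omega
      rcases hst with ⟨hs2, ht⟩ | ⟨hs2, ht⟩
      · -- roles `(U, S, T)`
        exact quot_cyclic_of_shapeB_tpp_or hρρ hρτ hτρ hττ hρ hτ hne hsurj hUST (by omega) hs2 (by omega) ht
          (by omega) hV_UST hc₀
      · -- roles `(U, T, S)`
        exact quot_cyclic_of_shapeB_tpp_or hρρ hρτ hτρ hττ hρ hτ hne hsurj hUTS (by omega) ht (by omega) hs2
          (by omega) hV_UTS hc₀

/-- **Dicyclic type: the mod-one law forces `A/⟨c₀⟩` cyclic.**  `c₀ ≠ 0`, `|A| ≡ 1 (mod 3)`, `|A| ≥ 14`; a TPP triple with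
`3|S||T||U| + 8 = 8|A|` gives `g` with `A = ⟨g⟩ ∪ (c₀ + ⟨g⟩)`. [folklore] -/
theorem quot_cyclic_of_mod_one_law_of_c0_ne_zero
    (hρρ : ∀ a b, ρ a * ρ b = ρ (a + b)) (hρτ : ∀ a b, ρ a * τ b = τ (b - a))
    (hτρ : ∀ a b, τ a * ρ b = τ (a + b)) (hττ : ∀ a b, τ a * τ b = ρ (c₀ + b - a)) (hc₀ : c₀ ≠ 0)
    (hρ : Function.Injective ρ) (hτ : Function.Injective τ) (hne : ∀ a b, ρ a ≠ τ b)
    (hsurj : ∀ g, (∃ a, ρ a = g) ∨ (∃ a, τ a = g)) (hmod : Fintype.card A % 3 = 1) (hA : 14 ≤ Fintype.card A)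
    (h : TripleProductProperty S T U) (hV : 3 * (S.card * T.card * U.card) + 8 = 8 * Fintype.card A) :
    ∃ g : A, ∀ x : A, x ∈ AddSubgroup.zmultiples g ∨ x + c₀ ∈ AddSubgroup.zmultiples g := by
  by_cases hnc : ((univ.filter fun a : A => ρ a ∈ S).card = (univ.filter fun a : A => τ a ∈ S).card ∧
      (univ.filter fun a : A => ρ a ∈ T).card = (univ.filter fun a : A => τ a ∈ T).card ∧
      (univ.filter fun a : A => ρ a ∈ U).card = (univ.filter fun a : A => τ a ∈ U).card)
  · exact (no_cube_law_of_c0_ne_zero hρρ hρτ hτρ hττ hc₀ hρ hτ hne hsurj h hnc.1 hnc.2.1 hnc.2.2 hV).elim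
  · exact quot_cyclic_of_mod_one_law_of_not_cube_c0 hρρ hρτ hτρ hττ hρ hτ hne hsurj hmod hA h hV hnc hc₀

omit [DecidableEq A] [Fintype A] in
/-- If `A = ⟨g⟩ ∪ (c₀ + ⟨g⟩)`, `c₀ = a + a` is a double and `2c₀ = 0`, then `A = ⟨g⟩` is cyclic
(`c₀ = 2a = 2(a + c₀) ∈ ⟨g⟩`). [folklore] -/
theorem cyclic_of_quot_cyclic_of_double {g c₀ a : A} (ha : a + a = c₀) (h2c : c₀ + c₀ = 0)
    (hg : ∀ x : A, x ∈ AddSubgroup.zmultiples g ∨ x + c₀ ∈ AddSubgroup.zmultiples g) :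
    ∀ x : A, x ∈ AddSubgroup.zmultiples g := by
  set D := AddSubgroup.zmultiples g
  have hc : c₀ ∈ D := by
    rcases hg a with h | h
    · rw [← ha]; exact D.add_mem h h
    · have h2 := D.add_mem h h
      rwa [show a + c₀ + (a + c₀) = (a + a) + (c₀ + c₀) by abel, ha, h2c, add_zero] at h2
  intro x
  rcases hg x with hx | hx
  · exact hx
  · have := D.sub_mem hx hc
    rwa [add_sub_cancel_right] at this

/-- **`c₀ ∈ 2A`, `A` not cyclic ⇒ no law.**  Dihedral-like presentation with `c₀ = a + a ≠ 0` over a NON-cyclic `A`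
(`|A| ≡ 1 (mod 3)`, `|A| ≥ 14`): no TPP triple attains `3|S||T||U| + 8 = 8|A|`. [folklore] -/
theorem no_mod_one_law_of_c0_double
    (hρρ : ∀ a b, ρ a * ρ b = ρ (a + b)) (hρτ : ∀ a b, ρ a * τ b = τ (b - a))
    (hτρ : ∀ a b, τ a * ρ b = τ (a + b)) (hττ : ∀ a b, τ a * τ b = ρ (c₀ + b - a)) (hc₀ : c₀ ≠ 0)
    {a : A} (ha : a + a = c₀) (hnc : ¬ ∃ g : A, ∀ x : A, x ∈ AddSubgroup.zmultiples g)
    (hρ : Function.Injective ρ) (hτ : Function.Injective τ) (hne : ∀ a b, ρ a ≠ τ b)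
    (hsurj : ∀ g, (∃ a, ρ a = g) ∨ (∃ a, τ a = g)) (hmod : Fintype.card A % 3 = 1) (hA : 14 ≤ Fintype.card A)
    (h : TripleProductProperty S T U) : 3 * (S.card * T.card * U.card) + 8 ≠ 8 * Fintype.card A := by
  intro hV
  obtain ⟨g, hg⟩ := quot_cyclic_of_mod_one_law_of_c0_ne_zero hρρ hρτ hτρ hττ hc₀ hρ hτ hne hsurj hmod hA h hV
  exact hnc ⟨g, cyclic_of_quot_cyclic_of_double ha (two_c0_eq_zero hρτ hτρ hττ hτ) hg⟩

end DihedralLike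

section C2Quaternion

variable {n : ℕ} [NeZero n] {G : Type} [Group G] [DecidableEq G] {ρ τ : ZMod 2 × ZMod n → G} {S T U : Finset G}

/-- **Hypothesis H′ of the census: `C₂ × Q_{2n}` attains no law triple.**  Any dihedral-like group over
`A = ℤ₂ × ℤ_n` with `4 ∣ n`, `n ≡ 2 (mod 3)` (so `n ≥ 8`) and `c₀ = (0, n/2)` (`= C₂ × Q_{2n}`: `|A| = 2n = 16, 40, 64, 88, …`)
has NO TPP triple with `3|S||T||U| + 8 = 8|A| = 16n` — although `A` has a cyclic subgroup of index `2`
(`c₀ = 2·(0, n/4) ∈ 2A` and `A` is not cyclic). [folklore] -/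
theorem no_mod_one_law_Z2_Zn_half (hn4 : 4 ∣ n) (hmod : n % 3 = 2)
    (hρρ : ∀ a b, ρ a * ρ b = ρ (a + b))
    (hρτ : ∀ a b, ρ a * τ b = τ (b - a)) (hτρ : ∀ a b, τ a * ρ b = τ (a + b))
    (hττ : ∀ a b, τ a * τ b = ρ ((((0 : ZMod 2), ((n / 2 : ℕ) : ZMod n)) : ZMod 2 × ZMod n) + b - a))
    (hρ : Function.Injective ρ) (hτ : Function.Injective τ) (hne : ∀ a b, ρ a ≠ τ b)
    (hsurj : ∀ g, (∃ a, ρ a = g) ∨ (∃ a, τ a = g)) (h : TripleProductProperty S T U) :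
    3 * (S.card * T.card * U.card) + 8 ≠ 16 * n := by
  have hcard : Fintype.card (ZMod 2 × ZMod n) = 2 * n := by rw [Fintype.card_prod, ZMod.card, ZMod.card]
  have hc₀ : (((0 : ZMod 2), ((n / 2 : ℕ) : ZMod n)) : ZMod 2 × ZMod n) ≠ 0 := by
    intro h0
    have h1 : ((n / 2 : ℕ) : ZMod n) = 0 := congrArg Prod.snd h0
    rw [ZMod.natCast_eq_zero_iff] at h1
    have := Nat.le_of_dvd (by omega) h1
    omega
  have ha : (((0 : ZMod 2), ((n / 4 : ℕ) : ZMod n)) : ZMod 2 × ZMod n) + (0, ((n / 4 : ℕ) : ZMod n)) =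
      (0, ((n / 2 : ℕ) : ZMod n)) := by
    refine Prod.ext (by simp) ?_
    show ((n / 4 : ℕ) : ZMod n) + ((n / 4 : ℕ) : ZMod n) = ((n / 2 : ℕ) : ZMod n)
    rw [← Nat.cast_add]; congr 1; omega
  have key := no_mod_one_law_of_c0_double hρρ hρτ hτρ hττ hc₀ ha
    (not_cyclic_zmod_two_prod (dvd_trans (by norm_num) hn4)) hρ hτ hne hsurj (by rw [hcard]; omega)
    (by rw [hcard]; omega) h
  rwa [hcard, show 8 * (2 * n) = 16 * n by ring] at key

end C2Quaternion

end Summit.MatrixMultiplication.OmegaCensus
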